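import Summits.BirchSwinnertonDyer.BirchSwinnertonDyer.Theorems.TwistFamilyManinDescentEisensteinTwistedLatticeDichotomy
import Summits.BirchSwinnertonDyer.BirchSwinnertonDyer.Theorems.ManinLocalTwoThreeManinPrimeToAdditiveFiveLeIsogenyMinimalDiscriminantRigidity
import HarnessLib

/-!
# Route `ManinLocalTwoThree`, residual crux C5 `ManinPrimeToAdditiveFiveLe` (stmt-BirchSwinnertonDyer-22969), line `upper_anchor`
# (skeleton v15, stub `stub_printedInputs`): the `13`-core's twisted period-lattice DICHOTOMY WITHOUT the cite-only input `hDD`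
# (Dokchitser–Dokchitser 2015 Thm. 5.1 (1)) — its one use is the tree THEOREM
# `padicValInt_minimalDiscriminantInt_eq_of_isIsogenous_of_typeGOrd` (piece ω1, this seat)

Width seat bsd-line-ml23-c5-p1-w2 (gen 6), piece ω2. THEOREMS ONLY (no definition, no named fact, no `sorry`).

`index_dichotomy_of_strongIsTop_noDD` is pub/bsd-wall seat bsd-line-ttd-p1's
`EisensteinTrichotomy.index_dichotomy_of_strongIsTop` (`TwistFamilyManinDescentEisensteinTwistedLatticeDichotomy.lean`, VERBATIM
statement minus the binder `hDD`, proof adapted verbatim — attribution: that seat's g6 file) with its single rigidity step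
`ord_p Δ_min(W₀) = ord_p Δ_min(V)` (`W₀ ∼ V`, `V` additive (G)-ordinary at `p = 13`) supplied by the kernel theorem
`padicValInt_minimalDiscriminantInt_eq_of_isIsogenous_of_typeGOrd` (Coates' congruence + cyclic prime-step factorisation + the discharged
clause `l ≠ p`; file `…IsogenyMinimalDiscriminantRigidity.lean`) instead of the cite-only named fact
`dokchitser_padicValInt_minimalDiscriminantInt_eq_of_isogeny_of_potentiallyGoodOrdinary`. The sequel file re-keys the core
`not_dvd_c_of_notBottom_of_strongIsTop` / `not_dvd_c_large` and the single-book ledger of C5 the same way (FOUR prints).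

HONEST STATUS (`--supports 22969`, helper): C2 (`EisensteinOrdinaryStrongIsTop`, stmt-26929) is an OPEN item and modularity
(`exists_isNewformOf`) a cite-only print; nothing here proves BSD, Manin's conjecture, C5, C1 or C2. The gain: the dichotomy no longer
depends on Dokchitser–Dokchitser 2015 as a hypothesis.
[cite: EdixhovenManin1991, §4 (the lattice sandwich)] [cite: Stevens1989, Lemma (5.4) p. 97]
[cite: DokchitserDokchitser2015LocalInvariants, Thm. 5.1 (1) and Cor. 8 (now a tree theorem at `p ≥ 5` on the (G)-locus)]
-/

set_option autoImplicit false
-- single-conjunct summit: `Summit.BirchSwinnertonDyer.BirchSwinnertonDyer.…` repeats the name by design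
set_option linter.dupNamespace false

noncomputable section

open scoped Classical NumberField

open WeierstrassCurve IsDedekindDomain Rat.HeightOneSpectrum NumberField
  Literature.NumberTheory.EllipticCurves Literature.NumberTheory.EllipticCurves.ModularForms
  Literature.NumberTheory.EllipticCurves.Rank1Residual
  Summit.BirchSwinnertonDyer.Rank1Residual Summit.BirchSwinnertonDyer.Rank1Residual.Additive
  Summit.BirchSwinnertonDyer.Rank1Residual.ManinAdditive
  Summit.BirchSwinnertonDyer.BirchSwinnertonDyer.Theorems.TeichmullerTwistDescentStarInvolution
  Summit.BirchSwinnertonDyer.BirchSwinnertonDyer.Theses.TwistFamilyManinDescent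

namespace Summit.BirchSwinnertonDyer.BirchSwinnertonDyer.Theorems.TwistFamilyManinDescent.EisensteinTrichotomy

open TeichmullerTwistDescent.PeriodLatticeIndexParity TeichmullerTwistDescent.TwistedPeriodLatticeIndexFrame

/-! ### The dichotomy at `13` without `hDD` (adapted verbatim from bsd-line-ttd-p1's `index_dichotomy_of_strongIsTop`) -/

/-- **Twisted period-lattice dichotomy on the reducible (G)-ordinary unstarred rows at `13`, GRANTED
StrongIsTop (C2) and modularity — rigidity is now the tree THEOREM
`padicValInt_minimalDiscriminantInt_eq_of_isIsogenous_of_typeGOrd` (no `hDD`).** `W/ℚ` globally minimal with a LATTICE-OPTIMAL conductor-level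
datum `D`, `p = 13`, `p² ∣ N`, `W[p]` reducible, `W` (G)-ordinary, `ord_p Δ_min(W) ≤ 4`, `χ` primitive
quadratic mod `p`: `Λ(f_D) ⊆ g(χ)·Λ(f_D ⊗ χ)` or `g(χ)·Λ(f_D ⊗ χ) ⊆ p·Λ(f_D)`. The middle member would
give `ord_p c = ord_p c₀` (C2 at the twisted optimal curve `W₀`, frame `(V, Λ_V, cu/c₀)`) and
`ord_p c = ord_p c₀ + 1` (C2 at `W`, frame `(Ṽ₀, Λ_{Ṽ₀}, u₀c₀/c)` with `ord_p u₀ = 1` because `W₀` is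
STARRED by rigidity). [cite: EdixhovenManin1991, §4] [cite: Stevens1989, Lemma (5.4) p. 97]
[cite: DokchitserDokchitser2015LocalInvariants, Thm. 5.1 (1)] -/
theorem index_dichotomy_of_strongIsTop_noDD (hnf : exists_isNewformOf) (hC2 : EisensteinOrdinaryStrongIsTop)
    (W : WeierstrassCurve ℚ) [W.IsElliptic] [W.IsGloballyMinimal] (p : ℕ) [Fact p.Prime]
    [NeZero (W.conductorNorm ℤ)] (D : ModularParametrizationData W (W.conductorNorm ℤ))
    (hsq : p ^ 2 ∣ W.conductorNorm ℤ) (hp13 : p = 13) (hred : ¬ Rank1Residual.Irr W p)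
    (hGo : TypeGOrd W p) (hV4 : padicValInt p W.minimalDiscriminantInt ≤ 4)
    (hopt : ∀ z ∈ D.L.lattice, ∃ w ∈ periodLattice D.f, z = D.c * w)
    (χ : DirichletCharacter ℂ p) (hχ : χ.IsQuadratic) (hprim : χ.IsPrimitive) :
    (∀ z ∈ periodLattice D.f, ∃ w ∈ periodLattice
        (charTwist (W.conductorNorm ℤ) (dvd_refl _) hsq hχ D.f),
        z = gaussSum χ (ZMod.stdAddChar (N := p)) * w) ∨
    (∀ w ∈ periodLattice (charTwist (W.conductorNorm ℤ) (dvd_refl _) hsq hχ D.f),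
        ∃ z ∈ periodLattice D.f, gaussSum χ (ZMod.stdAddChar (N := p)) * w = (p : ℂ) * z) := by
  have hpP : p.Prime := Fact.out
  have hp11 : 11 ≤ p := by omega
  have hp2 : p ≠ 2 := by omega
  have hp5 : 5 ≤ p := by omega
  have hadd : Rank1Residual.Addv W p := not_good_and_not_mult_of_sq_dvd_conductorNorm W hsq
  have hj : 0 ≤ padicValRat p W.j := padicValRat_j_nonneg_of_typeGOrd W p hGo
  have hW6 : padicValInt p W.minimalDiscriminantInt < 6 := by omega
  -- `χ` is THE quadratic character mod `p`
  obtain rfl : χ = (quadraticChar (ZMod p)).ringHomComp (Int.castRingHom ℂ) :=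
    eq_of_isQuadratic_of_ne_one hχ (ne_one_of_isPrimitive hprim hpP.ne_one)
      (isQuadratic_quadraticChar_ringHomComp p)
      (ne_one_of_isPrimitive (isPrimitive_quadraticChar_ringHomComp p hp2) hpP.ne_one)
  set G : ℂ := gaussSum ((quadraticChar (ZMod p)).ringHomComp (Int.castRingHom ℂ))
    (ZMod.stdAddChar (N := p)) with hGdef
  have hG0 : G ≠ 0 := gaussSum_stdAddChar_ne_zero_of_isPrimitive hprim
  have hG2 : G ^ 2 = ((quadraticChar (ZMod p)).ringHomComp (Int.castRingHom ℂ)) (-1) * (p : ℂ) :=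
    gaussSum_stdAddChar_sq hχ hprim
  set ε : ℂ := ((quadraticChar (ZMod p)).ringHomComp (Int.castRingHom ℂ)) (-1) with hεdef
  have hε2 : ε ^ 2 = 1 := apply_sq_eq_one_of_isQuadratic hχ isUnit_one.neg
  have hpG : (p : ℂ) = ε * G ^ 2 := by
    rw [hG2, ← mul_assoc, ← sq, hε2, one_mul]
  set fχ := charTwist (W.conductorNorm ℤ) (dvd_refl _) hsq hχ D.f with hfχdef
  -- the frame `pΛ(f) ⊆ GΛ(f ⊗ χ) ⊆ Λ(f)`
  have hStevens : ∀ w ∈ periodLattice fχ, G * w ∈ periodLattice D.f := fun w hw ↦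
    gaussSum_mul_mem_periodLattice_of_mem_charTwist (W.conductorNorm ℤ) (dvd_refl _) hsq hχ hprim D.f hw
  have hFrame : ∀ z ∈ periodLattice D.f, ∃ w ∈ periodLattice fχ, (p : ℂ) * z = G * w := fun z hz ↦
    natCast_mul_mem_gaussSum_mul_periodLattice_charTwist_of_modularParametrizationData W p D hsq _ hχ hprim hz
  -- suppose the middle member: neither top nor bottom
  by_contra hmid
  obtain ⟨htop, hbot⟩ := not_or.mp hmid
  -- the twist frame of `W`
  obtain ⟨V, W₀, hVe, hVm, hE₀, hM₀, C, LV, D₀, hC, hu, hAV, hjV, hvV, hLV, hiso, hN₀, hopt₀, hfeq⟩ :=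
    exists_twist_frame hnf W p D hsq hp5 hadd hj hW6 hχ
  haveI := hVe
  haveI := hVm
  haveI := hE₀
  haveI := hM₀
  haveI : NeZero (W₀.conductorNorm ℤ) := ⟨(conductorNorm_pos_holds W₀).ne'⟩
  have htw : ∀ x : ℂ, x ∈ LV.lattice ↔ G * ((((C.u : ℚ) : ℂ))⁻¹ * x) ∈ D.L.lattice := fun x ↦
    mem_lattice_twist_pStar_iff p hp2 W V D.isNeronLattice hLV C hC x
  -- `W₀`: additive, reducible, (G)-ordinary, STARRED (rigidity)
  have hd0 : ((-1 : ℚ) ^ (p / 2) * p) ≠ 0 :=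
    mul_ne_zero (pow_ne_zero _ (by norm_num)) (by exact_mod_cast hpP.ne_zero)
  have hC' : C⁻¹ • V = W.quadraticTwist ((-1 : ℚ) ^ (p / 2) * p) := by rw [← hC, inv_smul_smul]
  have hredV : ¬ V.HasIrreducibleModPGaloisRep p := fun h ↦
    hred ((hasIrreducibleModPGaloisRep_iff_of_smul_eq_quadraticTwist W V hd0 hC' p).mp h)
  have hred₀ : ¬ Rank1Residual.Irr W₀ p := not_hasIrreducibleModPGaloisRep_of_isIsogenous hiso hredV
  have hGoV : TypeGOrd V p :=
    (typeGOrd_iff_of_star_pair p hp5 V W hAV hadd hjV hj (by omega)).mpr hGo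
  have hadd₀ : Rank1Residual.Addv W₀ p := (X2.addv_iff_of_isIsogenous (p := p) hiso).mp hAV
  have hGo₀ : TypeGOrd W₀ p := hGoV.of_isIsogenous hp2 hAV hiso
  have hj₀ : 0 ≤ padicValRat p W₀.j := padicValRat_j_nonneg_of_typeGOrd W₀ p hGo₀
  have hv₀ : padicValInt p W₀.minimalDiscriminantInt = padicValInt p W.minimalDiscriminantInt + 6 := by
    rw [← hvV]
    exact (padicValInt_minimalDiscriminantInt_eq_of_isIsogenous_of_typeGOrd hp5 hiso hAV hGoV).symm
  -- the twist `Ṽ₀` of the STARRED `W₀`: scaling `ord_p u₀ = 1`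
  obtain ⟨T, hTe, hTm, C₀, hC₀⟩ := exists_minimal_twist_pStar p W₀
  haveI := hTe
  haveI := hTm
  have hvW := padicValInt_minimalDiscriminantInt_mem_of_addv_of_padicValRat_j_nonneg W p hp5 hadd hj
  obtain ⟨-, -, -, -, hu₀⟩ := unstarred_twist_of_starred p hp5 W₀ T hadd₀ hj₀ (by omega) C₀ hC₀
  haveI : (T.baseChange ℂ).IsElliptic := by rw [WeierstrassCurve.baseChange]; infer_instance
  obtain ⟨LT, hLT⟩ := exists_isNeronLatticeOf_holds (T.baseChange ℂ)
  have htw₀ : ∀ x : ℂ, x ∈ LT.lattice ↔ G * ((((C₀.u : ℚ) : ℂ))⁻¹ * x) ∈ D₀.L.lattice := fun x ↦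
    mem_lattice_twist_pStar_iff p hp2 W₀ T D₀.isNeronLattice hLT C₀ hC₀ x
  -- constants
  have hc : D.c ≠ 0 := D.maninConstant_ne_zero_holds
  have hc₀0 : D₀.c ≠ 0 := D₀.maninConstant_ne_zero_holds
  have hu0 : (C.u : ℚ) ≠ 0 := C.u.ne_zero
  have hu₀0 : (C₀.u : ℚ) ≠ 0 := C₀.u.ne_zero
  have hcℂ : (D.c : ℂ) ≠ 0 := by exact_mod_cast hc
  have hc₀ℂ : (D₀.c : ℂ) ≠ 0 := by exact_mod_cast hc₀0
  have huℂ : (((C.u : ℚ) : ℚ) : ℂ) ≠ 0 := by exact_mod_cast hu0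
  have hu₀ℂ : (((C₀.u : ℚ) : ℚ) : ℂ) ≠ 0 := by exact_mod_cast hu₀0
  have hpℂ : (p : ℂ) ≠ 0 := by exact_mod_cast hpP.ne_zero
  have hUinv : ∀ t : ℂ, t = (((C.u : ℚ) : ℚ) : ℂ) * (((((C.u : ℚ) : ℚ) : ℂ))⁻¹ * t) := fun t ↦ by
    rw [← mul_assoc, mul_inv_cancel₀ huℂ, one_mul]
  have hU₀inv : ∀ t : ℂ, t = (((C₀.u : ℚ) : ℚ) : ℂ) * (((((C₀.u : ℚ) : ℚ) : ℂ))⁻¹ * t) := fun t ↦ by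
    rw [← mul_assoc, mul_inv_cancel₀ hu₀ℂ, one_mul]
  -- the witnesses of strictness
  have htop' : ∃ z₀ ∈ periodLattice D.f, ∀ w ∈ periodLattice fχ, z₀ ≠ G * w := by
    have h := htop
    push Not at h
    exact h
  have hbot' : ∃ w₀ ∈ periodLattice fχ, ∀ z ∈ periodLattice D.f, G * w₀ ≠ (p : ℂ) * z := by
    have h := hbot
    push Not at h
    exact h
  obtain ⟨z₀, hz₀, hz₀ne⟩ := htop'
  obtain ⟨w₀, hw₀, hw₀ne⟩ := hbot'
  /- [B] C2 at `W₀` with `(W', L', μ) = (V, Λ_V, q)`, `q = c u / c₀`: `ord_p q = 0` -/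
  set q : ℚ := (D.c : ℚ) * (C.u : ℚ) / (D₀.c : ℚ) with hqdef
  have hqℂ : ((q : ℚ) : ℂ) = (D.c : ℂ) * (((C.u : ℚ) : ℚ) : ℂ) / (D₀.c : ℂ) := by
    rw [hqdef]; push_cast; ring
  have hq1 : ∀ t : ℂ, ((q : ℚ) : ℂ) * ((D₀.c : ℂ) * t) = (D.c : ℂ) * (((C.u : ℚ) : ℚ) : ℂ) * t := by
    intro t
    rw [hqℂ]
    field_simp
  have hB1 : ∀ y ∈ D₀.L.lattice, ((q : ℚ) : ℂ) * y ∈ LV.lattice := by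
    intro y hy
    obtain ⟨w', hw', rfl⟩ := hopt₀ y hy
    rw [← hfeq] at hw'
    have h1 : (D.c : ℂ) * (G * w') ∈ D.L.lattice := D.smul_periodLattice_le _ (hStevens w' hw')
    rw [htw, hqℂ]
    convert h1 using 1
    field_simp
  have hB2 : ∃ z ∈ LV.lattice, ∀ y ∈ D₀.L.lattice, z ≠ ((q : ℚ) : ℂ) * y := by
    have h1 : (D.c : ℂ) * z₀ ∈ D.L.lattice := D.smul_periodLattice_le _ hz₀
    set x : ℂ := (((C.u : ℚ) : ℚ) : ℂ) * ((D.c : ℂ) * z₀) / G with hx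
    have hxV : x ∈ LV.lattice := by
      rw [htw]
      convert h1 using 1
      rw [hx]; field_simp
    refine ⟨x, hxV, fun y hy hxy ↦ ?_⟩
    obtain ⟨w, hw, rfl⟩ := hopt₀ y hy
    rw [← hfeq] at hw
    refine hz₀ne w hw ?_
    rw [hq1] at hxy
    have i2 : x * G = (((C.u : ℚ) : ℚ) : ℂ) * ((D.c : ℂ) * z₀) := by
      rw [hx]
      exact div_mul_cancel₀ _ hG0
    rw [hxy] at i2
    have key : (D.c : ℂ) * (((C.u : ℚ) : ℚ) : ℂ) * z₀ =
        (D.c : ℂ) * (((C.u : ℚ) : ℚ) : ℂ) * (G * w) := by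
      linear_combination -i2
    exact mul_left_cancel₀ (mul_ne_zero hcℂ huℂ) key
  have hB3 : ∀ z ∈ LV.lattice, ∃ y ∈ D₀.L.lattice, (p : ℂ) * z = ((q : ℚ) : ℂ) * y := by
    intro y hy
    have h1 := (htw y).mp hy
    obtain ⟨z, hz, hz'⟩ := hopt _ h1
    obtain ⟨w', hw', hw''⟩ := hFrame z hz
    refine ⟨(D₀.c : ℂ) * w', D₀.smul_periodLattice_le _ (hfeq ▸ hw'), ?_⟩
    rw [hq1, hUinv y]
    apply mul_left_cancel₀ hG0
    linear_combination ((p : ℂ) * (((C.u : ℚ) : ℚ) : ℂ)) * hz' +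
      ((D.c : ℂ) * (((C.u : ℚ) : ℚ) : ℂ)) * hw''
  have hB4 : ∃ y ∈ D₀.L.lattice, ∀ z ∈ LV.lattice, ((q : ℚ) : ℂ) * y ≠ (p : ℂ) * z := by
    have hy₀ : (D₀.c : ℂ) * w₀ ∈ D₀.L.lattice := D₀.smul_periodLattice_le _ (hfeq ▸ hw₀)
    refine ⟨(D₀.c : ℂ) * w₀, hy₀, fun x hx hxe ↦ ?_⟩
    have h1 := (htw x).mp hx
    obtain ⟨z, hz, hz'⟩ := hopt _ h1
    refine hw₀ne z hz ?_
    rw [hq1, hUinv x] at hxe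
    have key : (D.c : ℂ) * (((C.u : ℚ) : ℚ) : ℂ) * (G * w₀) =
        (D.c : ℂ) * (((C.u : ℚ) : ℚ) : ℂ) * ((p : ℂ) * z) := by
      linear_combination G * hxe + ((p : ℂ) * (((C.u : ℚ) : ℚ) : ℂ)) * hz'
    exact mul_left_cancel₀ (mul_ne_zero hcℂ huℂ) key
  have hC2' : ∀ (M : ℕ) [NeZero M] (_ : W₀.conductorNorm ℤ = M)
      (E : ModularParametrizationData W₀ M),
      (∀ z ∈ E.L.lattice, ∃ w ∈ periodLattice E.f, z = E.c * w) →
      ∀ μ : ℚ, (∀ y ∈ E.L.lattice, (μ : ℂ) * y ∈ LV.lattice) →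
        (∃ z ∈ LV.lattice, ∀ y ∈ E.L.lattice, z ≠ (μ : ℂ) * y) →
        (∀ z ∈ LV.lattice, ∃ y ∈ E.L.lattice, (p : ℂ) * z = (μ : ℂ) * y) →
        (∃ y ∈ E.L.lattice, ∀ z ∈ LV.lattice, (μ : ℂ) * y ≠ (p : ℂ) * z) →
        padicValRat p μ = 0 := by
    intro M _ hM E
    subst hM
    exact fun hE μ ↦ hC2 W₀ p E hp13 hadd₀ hred₀ hGo₀ hE V LV hLV μ
  have hvq : padicValRat p q = 0 := hC2' _ hN₀ D₀ hopt₀ q hB1 hB2 hB3 hB4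
  /- [A] C2 at `W` with `(W', L', μ) = (Ṽ₀, Λ_{Ṽ₀}, r)`, `r = u₀ c₀ / c`: `ord_p r = 0` -/
  set r : ℚ := (C₀.u : ℚ) * (D₀.c : ℚ) / (D.c : ℚ) with hrdef
  have hrℂ : ((r : ℚ) : ℂ) = (((C₀.u : ℚ) : ℚ) : ℂ) * (D₀.c : ℂ) / (D.c : ℂ) := by
    rw [hrdef]; push_cast; ring
  have hr1 : ∀ t : ℂ, ((r : ℚ) : ℂ) * ((D.c : ℂ) * t) = (((C₀.u : ℚ) : ℚ) : ℂ) * (D₀.c : ℂ) * t := by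
    intro t
    rw [hrℂ]
    field_simp
  -- `G z = ε w` whenever `p z = G w`
  have hGz : ∀ z w : ℂ, (p : ℂ) * z = G * w → G * z = ε * w := by
    intro z w h
    apply mul_left_cancel₀ hpℂ
    have hsq' : G ^ 2 = ε * (p : ℂ) := hG2
    linear_combination G * h + w * hsq'
  have hA1 : ∀ y ∈ D.L.lattice, ((r : ℚ) : ℂ) * y ∈ LT.lattice := by
    intro y hy
    obtain ⟨z, hz, rfl⟩ := hopt y hy
    obtain ⟨w, hw, hzw⟩ := hFrame z hz
    have hw1 : ε * w ∈ periodLattice fχ := quadratic_apply_mul_mem hχ (-1) hw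
    rw [hfχdef, hfeq] at hw1
    have h1 : (D₀.c : ℂ) * (ε * w) ∈ D₀.L.lattice := D₀.smul_periodLattice_le _ hw1
    rw [htw₀, hr1]
    have e := hGz z w hzw
    have e' : G * ((((C₀.u : ℚ) : ℚ) : ℂ)⁻¹ * ((((C₀.u : ℚ) : ℚ) : ℂ) * (D₀.c : ℂ) * z)) =
        (D₀.c : ℂ) * (ε * w) := by
      rw [show (((C₀.u : ℚ) : ℚ) : ℂ) * (D₀.c : ℂ) * z = (((C₀.u : ℚ) : ℚ) : ℂ) * ((D₀.c : ℂ) * z) by ring,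
        inv_mul_cancel_left₀ hu₀ℂ, ← e]
      ring
    rw [e']
    exact h1
  have hA3 : ∀ x ∈ LT.lattice, ∃ y ∈ D.L.lattice, (p : ℂ) * x = ((r : ℚ) : ℂ) * y := by
    intro x hx
    have h1 := (htw₀ x).mp hx
    obtain ⟨w', hw', hw''⟩ := hopt₀ _ h1
    rw [← hfeq] at hw'
    have h2 : (D.c : ℂ) * (ε * (G * w')) ∈ D.L.lattice :=
      D.smul_periodLattice_le _ (quadratic_apply_mul_mem hχ (-1) (hStevens w' hw'))
    refine ⟨(D.c : ℂ) * (ε * (G * w')), h2, ?_⟩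
    rw [hr1, hU₀inv x]
    apply mul_left_cancel₀ hG0
    linear_combination ((p : ℂ) * (((C₀.u : ℚ) : ℚ) : ℂ)) * hw'' +
      ((((C₀.u : ℚ) : ℚ) : ℂ) * (D₀.c : ℂ) * w') * hpG
  have hA2 : ∃ x ∈ LT.lattice, ∀ y ∈ D.L.lattice, x ≠ ((r : ℚ) : ℂ) * y := by
    have hy₀ : (D₀.c : ℂ) * w₀ ∈ D₀.L.lattice := D₀.smul_periodLattice_le _ (hfeq ▸ hw₀)
    set x : ℂ := (((C₀.u : ℚ) : ℚ) : ℂ) * ((D₀.c : ℂ) * w₀) / G with hx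
    have hxT : x ∈ LT.lattice := by
      rw [htw₀]
      convert hy₀ using 1
      rw [hx]; field_simp
    refine ⟨x, hxT, fun y hy hxy ↦ ?_⟩
    obtain ⟨z, hz, rfl⟩ := hopt y hy
    refine hw₀ne (ε * z) (quadratic_apply_mul_mem hχ (-1) hz) ?_
    rw [hr1] at hxy
    have i2 : x * G = (((C₀.u : ℚ) : ℚ) : ℂ) * ((D₀.c : ℂ) * w₀) := by
      rw [hx]
      exact div_mul_cancel₀ _ hG0
    rw [hxy] at i2
    -- `u₀ c₀ z G = u₀ c₀ w₀`, so `w₀ = G z` and `G w₀ = G² z = ε p z`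
    have key : (((C₀.u : ℚ) : ℚ) : ℂ) * (D₀.c : ℂ) * w₀ = (((C₀.u : ℚ) : ℚ) : ℂ) * (D₀.c : ℂ) * (G * z) := by
      linear_combination -i2
    have hwz : w₀ = G * z := mul_left_cancel₀ (mul_ne_zero hu₀ℂ hc₀ℂ) key
    rw [hwz, hpG]
    linear_combination (-(G ^ 2 * z)) * hε2
  have hA4 : ∃ y ∈ D.L.lattice, ∀ x ∈ LT.lattice, ((r : ℚ) : ℂ) * y ≠ (p : ℂ) * x := by
    have hy : (D.c : ℂ) * z₀ ∈ D.L.lattice := D.smul_periodLattice_le _ hz₀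
    refine ⟨(D.c : ℂ) * z₀, hy, fun x hx hxe ↦ ?_⟩
    have h1 := (htw₀ x).mp hx
    obtain ⟨w', hw', hw''⟩ := hopt₀ _ h1
    rw [← hfeq] at hw'
    refine hz₀ne (ε * w') (quadratic_apply_mul_mem hχ (-1) hw') ?_
    rw [hr1, hU₀inv x] at hxe
    -- `u₀ c₀ z₀ = p x`, `G u₀⁻¹ x = c₀ w'` ⇒ `z₀ = (p/G) w' = ε G w'`
    apply mul_left_cancel₀ (mul_ne_zero hu₀ℂ hc₀ℂ)
    apply mul_left_cancel₀ hG0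
    linear_combination G * hxe + ((p : ℂ) * (((C₀.u : ℚ) : ℚ) : ℂ)) * hw'' +
      ((((C₀.u : ℚ) : ℚ) : ℂ) * (D₀.c : ℂ) * w') * hpG
  have hvr : padicValRat p r = 0 :=
    hC2 W p D hp13 hadd hred hGo hopt T LT hLT r hA1 hA2 hA3 hA4
  -- valuation count: `ord q = ord c + ord u − ord c₀ = 0`, `ord r = ord u₀ + ord c₀ − ord c = 0`,
  -- `ord u = 0`, `ord u₀ = 1`
  have e1 : padicValRat p q = padicValRat p (D.c : ℚ) + padicValRat p (C.u : ℚ) -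
      padicValRat p (D₀.c : ℚ) := by
    rw [hqdef, padicValRat.div (mul_ne_zero (by exact_mod_cast hc) hu0) (by exact_mod_cast hc₀0),
      padicValRat.mul (by exact_mod_cast hc) hu0]
  have e2 : padicValRat p r = padicValRat p (C₀.u : ℚ) + padicValRat p (D₀.c : ℚ) -
      padicValRat p (D.c : ℚ) := by
    rw [hrdef, padicValRat.div (mul_ne_zero hu₀0 (by exact_mod_cast hc₀0)) (by exact_mod_cast hc),
      padicValRat.mul hu₀0 (by exact_mod_cast hc₀0)]
  rw [hvq, hu] at e1
  rw [hvr, hu₀] at e2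
  linarith

end Summit.BirchSwinnertonDyer.BirchSwinnertonDyer.Theorems.TwistFamilyManinDescent.EisensteinTrichotomy

end
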